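import Mathlib
import HarnessLib
import Summits.ResolutionOfSingularities.ResolutionOfSingularities.Theorems.WildQuotientsWildQuotientResolutionToricExitTransferThree
import Summits.ResolutionOfSingularities.ResolutionOfSingularities.Theorems.WildQuotientsWildQuotientResolutionBlowupLocalExitDepthTwo

/-!
# The toric exit transfer with FOUR pieces, one of them of depth two (RUNG V5 = the `J₅` exit)
(crux stmt-ResolutionOfSingularities-15640 `WildQuotients.WildQuotientResolution`, line `Sketch`;
chain w45c RUNG V5 (`L/w45c/CHAIN.md` v8 §5, res-L1-w45c-plan-1 NAMING 2026-08-27T10:09:28Z),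
design `L/res-L1-w45c-idea-2/RT-J5.md` §2/§6 + `RT-LADDER.md` §3; [OURS · L1 W4.5c] — NOT a
statement of any manuscript; replaces the role of no printed item. Lead prover res-L1-w45c-lead-1.)

`ToricExit.toricExitTransfer₄` is the four-piece, depth-two analogue of
`ToricExit.toricExitTransfer₃` (p498981), i.e. the hypothesis-composed skeleton of the RUNG V5
final `JordanFive.jordanFive_hasResolution` (every `p ≥ 5`/`7`). Data: crux data
`(X', X₁, f, q, G, ρ)` with `|G| = p`, `ρ` faithful, `X₁` AFFINE integral of finite type and of
positive dimension, `q` finite surjective with orbit fibres and generically étale; an equivariant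
proper birational integral model `π : V → X'` with action `ρB` over `X₁`; FOUR `G`-stable opens
`O₀, O₁, O₂, O₃` of `V`, affine over `X₁`, covering `V`, with

* piece `3` Király–Lütkebohmert terminal: `O₃` non-empty and regular, and the stalk augmentation
  ideal principal at every fixed point of `O₃` — so `O₃/G` is regular
  (`ToricExit.isRegular_pieceQuot_of_stalkAug`, p487969);
* ONE closed `T ⊆ V` missing `O₃` — the first centre downstairs is the REDUCED image of `T` (for
  `J₅`: `T` = edge surface `∪` `μ₃`-vertex curve, RT-J5 §2 «`Sing V = S₀₂ ∪ C₁`»), SHARED by the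
  pieces it meets — and a set `T' ⊆ V` missing `O₁, O₂, O₃` (for `J₅`: the `μ₄`-vertex curve);
* pieces `1` and `2`: SOME blow-up of `Oᵢ/G` along the reduced ideal sheaf of the image of
  `T ∩ Oᵢ` is regular;
* piece `0` (DEPTH TWO): SOME blow-up `B` of `O₀/G` along the reduced image of `T ∩ O₀` carries a
  closed `C ⊆ B` lying over the image of `T' ∩ O₀` such that SOME blow-up of `B` along the reduced
  ideal sheaf of `C` is regular (one-shot pieces take `C = ⊥`).

Conclusion: `X₁` has a resolution of singularities — `Y = V/G` (Q1, p479608) is blown up along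
the ideal sheaf of `π(T)`, then along the transported `C` (`BlowupExit.hasResolution_of_isBlowup_
locally_regular₂`, p524622), and resolutions transfer along the proper birational `Y → X₁`
(`QuotientModel.hasResolution_of_hasResolution_glued`). Also: the image of ANY closed `T ⊆ V` in
`V/G` is closed, with chart traces the images of `T ∩ O` (`preimage_gluedι_image_gluedMk`,
`isClosed_gluedMk_image'`).
-/

-- single-problem summit: the doubled namespace component `ResolutionOfSingularities` is forced
set_option linter.dupNamespace false

noncomputable section

open CategoryTheory AlgebraicGeometry TopologicalSpace
open Literature.AlgebraicGeometry.Resolution Literature.AlgebraicGeometry.RelativeSpec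
open Literature.AlgebraicGeometry.CossartPiltant200819

namespace Summit.ResolutionOfSingularities.ResolutionOfSingularities.Theorems.WildQuotientResolution.ToricExit

/-- **Chart traces of images.** For ANY subset `T ⊆ X` and any stable affine open `O`, the
preimage in the chart `O/G ↪ X/G` of the image `π(T)` is the image of `T ∩ O` under `O → O/G`
(no containment hypothesis; uses only `π⁻¹(O/G) = O`). [folklore] -/
theorem preimage_gluedι_image_gluedMk {X S : Scheme.{0}} {r : X ⟶ S} {G : Type} [Group G]
    [Finite G] (ρ : ActionOver r G) [S.IsSeparated] [IsSeparated r]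
    (hcov : ∀ x : X, ∃ O : ρ.StableAffineOpens, x ∈ O.1) (O : ρ.StableAffineOpens)
    (T : Set X) :
    (ρ.gluedι O).base ⁻¹' ((ρ.gluedMk hcov).base '' T) = (ρ.pieceMk O).base '' (O.1.ι.base ⁻¹' T) := by
  ext y
  simp only [Set.mem_preimage, Set.mem_image]
  constructor
  · rintro ⟨t, ht, hty⟩
    have htO : t ∈ O.1 := by
      have h : t ∈ ρ.gluedMk hcov ⁻¹ᵁ (ρ.gluedι O).opensRange := by
        change (ρ.gluedMk hcov).base t ∈ (ρ.gluedι O).opensRange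
        rw [hty]
        exact ⟨y, rfl⟩
      rwa [ρ.preimage_opensRange_gluedι hcov O] at h
    refine ⟨⟨t, htO⟩, ht, ?_⟩
    apply (ρ.gluedι O).isOpenEmbedding.injective
    rw [← hty]
    exact (ρ.gluedMk_apply hcov O ⟨t, htO⟩).symm
  · rintro ⟨x, hx, rfl⟩
    exact ⟨x.1, hx, ρ.gluedMk_apply hcov O x⟩

/-- **The image in `X/G` of any closed `T ⊆ X` is closed** (the chart traces are images of closed
sets under the closed maps `O → O/G`). [folklore] -/
theorem isClosed_gluedMk_image' {X S : Scheme.{0}} {r : X ⟶ S} {G : Type} [Group G]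
    [Finite G] (ρ : ActionOver r G) [S.IsSeparated] [IsSeparated r]
    (hcov : ∀ x : X, ∃ O : ρ.StableAffineOpens, x ∈ O.1) (T : Set X) (hT : IsClosed T) :
    IsClosed ((ρ.gluedMk hcov).base '' T) := by
  have hc : ((ρ.gluedMk hcov).base '' T)ᶜ =
      ⋃ O : ρ.StableAffineOpens, (ρ.gluedι O).base '' ((ρ.gluedι O).base ⁻¹' ((ρ.gluedMk hcov).base '' T))ᶜ := by
    ext z
    simp only [Set.mem_compl_iff, Set.mem_iUnion, Set.mem_image, Set.mem_preimage]
    constructor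
    · intro hz
      obtain ⟨O, q, rfl⟩ := ρ.gluedι_jointly_surjective z
      exact ⟨O, q, hz, rfl⟩
    · rintro ⟨O, q, hq, rfl⟩
      exact hq
  rw [← isOpen_compl_iff, hc]
  refine isOpen_iUnion fun O => (ρ.gluedι O).isOpenEmbedding.isOpenMap _ ?_
  rw [isOpen_compl_iff, preimage_gluedι_image_gluedMk ρ hcov O T]
  exact BlowupExit.isClosedMap_pieceMk ρ O _ (hT.preimage O.1.ι.continuous)

-- the glued-quotient / blow-up bookkeeping is individually cheap but numerous
set_option maxHeartbeats 800000 in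
/-- **The toric exit transfer, four pieces, piece `0` of depth two.** Let `(X', X₁, f, q, G, ρ)`
be crux data with `|G| = p`, `ρ` faithful, `X₁` affine, integral, of finite type over `k` and of
positive dimension, `q` finite surjective with orbit fibres and étale over a dense open;
`π : V → X'` an equivariant proper birational integral model with action `ρB` over `X₁`;
`O₀, O₁, O₂, O₃` four `G`-stable opens of `V`, affine over `X₁`, with `O₀ ∪ O₁ ∪ O₂ ∪ O₃ = V`;
`O₃` non-empty, regular, with principal stalk augmentation ideals at its fixed points; `T ⊆ V`
closed and disjoint from `O₃`; `T' ⊆ V` disjoint from `O₁, O₂, O₃`; for `i = 1, 2` some blow-up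
of `Oᵢ/G` along the ideal sheaf of the image of `T ∩ Oᵢ` regular; and some blow-up `B` of `O₀/G`
along the ideal sheaf of the image of `T ∩ O₀` carrying a closed `C` over the image of `T' ∩ O₀`
with some blow-up of `B` along the ideal sheaf of `C` regular. Then `X₁` has a resolution of
singularities. [OURS · L1 W4.5c] [folklore; assembly of landed decls] -/
theorem toricExitTransfer₄ (p : ℕ) (hp : p.Prime) (k : Type) [Field k]
    (X' X₁ : Scheme.{0}) (f : X₁ ⟶ Spec (.of k)) (q : X' ⟶ X₁) (G : Type) [Group G] [Finite G]
    (ρ : G →* Aut X') (hcard : Nat.card G = p) (hfaith : Function.Injective ρ)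
    [IsAffine X₁] [LocallyOfFiniteType f] [IsIntegral X₁] [IsIntegral X']
    [IsFinite q] (hdim : ¬ topologicalKrullDim X₁ ≤ 0) (hsurj : Function.Surjective q.base)
    (hU : ∃ U : X₁.Opens, Dense (U : Set X₁) ∧ Etale (q ∣_ U))
    (horb : ∀ x y : X', q.base x = q.base y → ∃ g : G, (ρ g).hom.base x = y)
    (V : Scheme.{0}) (π : V ⟶ X') [IsProper π] (hbir : IsBirational π) [IsIntegral V]
    (ρB : ActionOver (π ≫ q) G)
    (hequiv : ∀ g : G, (ρB.aut g).hom ≫ π = π ≫ (ρ g).hom)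
    (O₀ O₁ O₂ O₃ : ρB.StableAffineOpens) (hcov₄ : O₀.1 ⊔ O₁.1 ⊔ O₂.1 ⊔ O₃.1 = ⊤)
    (hO₃ne : ((O₃.1 : V.Opens) : Set V).Nonempty)
    (hreg₃ : Scheme.IsRegular (O₃.1 : Scheme.{0}))
    (hdiv₃ : ∀ (g : G) (v : V) (hv : (ρB.aut g).hom.base v = v), v ∈ (O₃.1 : V.Opens) →
      (Ideal.span (Set.range fun s : V.presheaf.stalk v =>
        (V.presheaf.stalkSpecializes (specializes_of_eq hv) ≫ (ρB.aut g).hom.stalkMap v).hom s -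
          s)).IsPrincipal)
    (T : Set V) (hT : IsClosed T) (hT₃ : Disjoint T ((O₃.1 : V.Opens) : Set V))
    (T' : Set V) (hT'₁ : Disjoint T' ((O₁.1 : V.Opens) : Set V))
    (hT'₂ : Disjoint T' ((O₂.1 : V.Opens) : Set V)) (hT'₃ : Disjoint T' ((O₃.1 : V.Opens) : Set V))
    (hP₁ : ∀ (Z₁ : Closeds (ρB.pieceQuot O₁)),
      (Z₁ : Set (ρB.pieceQuot O₁)) = (ρB.pieceMk O₁).base '' (O₁.1.ι.base ⁻¹' T) →
      ∃ (B : Scheme.{0}) (pB : B ⟶ ρB.pieceQuot O₁),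
        IsBlowup pB (Scheme.IdealSheafData.vanishingIdeal Z₁) ∧ Scheme.IsRegular B)
    (hP₂ : ∀ (Z₂ : Closeds (ρB.pieceQuot O₂)),
      (Z₂ : Set (ρB.pieceQuot O₂)) = (ρB.pieceMk O₂).base '' (O₂.1.ι.base ⁻¹' T) →
      ∃ (B : Scheme.{0}) (pB : B ⟶ ρB.pieceQuot O₂),
        IsBlowup pB (Scheme.IdealSheafData.vanishingIdeal Z₂) ∧ Scheme.IsRegular B)
    (hP₀ : ∀ (Z₀ : Closeds (ρB.pieceQuot O₀)),
      (Z₀ : Set (ρB.pieceQuot O₀)) = (ρB.pieceMk O₀).base '' (O₀.1.ι.base ⁻¹' T) →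
      ∃ (B : Scheme.{0}) (pB : B ⟶ ρB.pieceQuot O₀),
        IsBlowup pB (Scheme.IdealSheafData.vanishingIdeal Z₀) ∧
        ∃ C : Closeds B,
          pB.base '' (C : Set B) ⊆ (ρB.pieceMk O₀).base '' (O₀.1.ι.base ⁻¹' T') ∧
          ∃ (B' : Scheme.{0}) (pB' : B' ⟶ B),
            IsBlowup pB' (Scheme.IdealSheafData.vanishingIdeal C) ∧ Scheme.IsRegular B') :
    Scheme.HasResolution X₁ := by
  classical
  -- separatedness and noetherianity
  haveI : X₁.IsSeparated := inferInstance
  haveI : X'.IsSeparated := ⟨by rw [← Limits.terminal.comp_from q]; infer_instance⟩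
  haveI : IsLocallyNoetherian X₁ := LocallyOfFiniteType.isLocallyNoetherian f
  -- the cover by `G`-stable opens affine over `X₁`
  have hcov : ∀ v : V, ∃ O : ρB.StableAffineOpens, v ∈ O.1 := by
    intro v
    have hv : v ∈ O₀.1 ⊔ O₁.1 ⊔ O₂.1 ⊔ O₃.1 := by rw [hcov₄]; exact Opens.mem_top v
    rcases Opens.mem_sup.mp hv with h | h
    · rcases Opens.mem_sup.mp h with h' | h'
      · rcases Opens.mem_sup.mp h' with h'' | h''
        · exact ⟨O₀, h''⟩
        · exact ⟨O₁, h''⟩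
      · exact ⟨O₂, h'⟩
    · exact ⟨O₃, h⟩
  -- `Y = V/G`: integral, proper and birational over `X₁`
  obtain ⟨hY, hr, hrbir⟩ := QuotientModel.quotientModel_proper_birational k X' X₁ f q G ρ hfaith
    hdim hsurj hU horb V π hbir ρB hequiv hcov
  haveI := hY
  haveI : IsLocallyNoetherian ρB.glued :=
    LocallyOfFiniteType.isLocallyNoetherian (ρB.gluedDesc (π ≫ q) ρB.aut_comp ≫ f)
  -- piece `3` is regular
  have hQ : Scheme.IsRegular (ρB.pieceQuot O₃) :=
    isRegular_pieceQuot_of_stalkAug ρB hp hcard O₃ hO₃ne hreg₃ hdiv₃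
  -- membership in a chart downstairs is membership in the stable open upstairs
  have mem_range : ∀ (O : ρB.StableAffineOpens) (v : V),
      (ρB.gluedMk hcov).base v ∈ (ρB.gluedι O).opensRange ↔ v ∈ O.1 := by
    intro O v
    change v ∈ ρB.gluedMk hcov ⁻¹ᵁ (ρB.gluedι O).opensRange ↔ _
    rw [ρB.preimage_opensRange_gluedι hcov O]
  -- the first centre: `Z = π(T)`, closed, missing the chart `O₃/G`
  let Z : Closeds ρB.glued := ⟨(ρB.gluedMk hcov).base '' T, isClosed_gluedMk_image' ρB hcov T hT⟩
  have hZcoe : (Z : Set ρB.glued) = (ρB.gluedMk hcov).base '' T := rfl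
  have hZ₃ : Disjoint ((ρB.gluedMk hcov).base '' T)
      ((ρB.gluedι O₃).opensRange : Set ρB.glued) :=
    BlowupExit.gluedMk_image_disjoint_opensRange ρB hcov T O₃ hT₃
  let 𝓘 : ρB.glued.IdealSheafData := Scheme.IdealSheafData.vanishingIdeal Z
  -- `𝓘 ≠ ⊥`: the non-empty chart `O₃/G` misses `Z`
  have h𝓘 : 𝓘 ≠ ⊥ := by
    intro hbot
    have hsupp : (𝓘.support : Set ρB.glued) = (Z : Set ρB.glued) :=
      Scheme.IdealSheafData.coe_support_vanishingIdeal Z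
    rw [Scheme.IdealSheafData.support_eq_top_iff.mpr hbot] at hsupp
    obtain ⟨v, hv⟩ := hO₃ne
    have hmem : (ρB.gluedMk hcov).base v ∈ (Z : Set ρB.glued) := hsupp ▸ trivial
    exact Set.disjoint_left.mp hZ₃ hmem ((mem_range O₃ v).mpr hv)
  -- the four charts downstairs
  let U : Fin 4 → ρB.glued.Opens :=
    ![(ρB.gluedι O₀).opensRange, (ρB.gluedι O₁).opensRange, (ρB.gluedι O₂).opensRange,
      (ρB.gluedι O₃).opensRange]
  have hU0 : U 0 = (ρB.gluedι O₀).opensRange := rfl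
  have hU1 : U 1 = (ρB.gluedι O₁).opensRange := rfl
  have hU2 : U 2 = (ρB.gluedι O₂).opensRange := rfl
  have hU3 : U 3 = (ρB.gluedι O₃).opensRange := rfl
  have hUcov : ⨆ i, U i = ⊤ := by
    rw [eq_top_iff]
    rintro z -
    obtain ⟨v, rfl⟩ := ρB.gluedMk_surjective hcov z
    have hv : v ∈ O₀.1 ⊔ O₁.1 ⊔ O₂.1 ⊔ O₃.1 := by rw [hcov₄]; exact Opens.mem_top v
    rcases Opens.mem_sup.mp hv with h | h
    · rcases Opens.mem_sup.mp h with h' | h'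
      · rcases Opens.mem_sup.mp h' with h'' | h''
        · exact Opens.mem_iSup.mpr ⟨0, (mem_range O₀ v).mpr h''⟩
        · exact Opens.mem_iSup.mpr ⟨1, (mem_range O₁ v).mpr h''⟩
      · exact Opens.mem_iSup.mpr ⟨2, (mem_range O₂ v).mpr h'⟩
    · exact Opens.mem_iSup.mpr ⟨3, (mem_range O₃ v).mpr h⟩
  -- transport of `∃ regular blow-up` along `Oᵢ/G ≅ its chart`
  have key : ∀ (O : ρB.StableAffineOpens),
      (∃ (B : Scheme.{0}) (pB : B ⟶ ρB.pieceQuot O),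
        IsBlowup pB (𝓘.comap (ρB.gluedι O)) ∧ Scheme.IsRegular B) →
      ∃ (B : Scheme.{0}) (pB : B ⟶ ((ρB.gluedι O).opensRange : Scheme.{0})),
        IsBlowup pB (𝓘.comap (ρB.gluedι O).opensRange.ι) ∧ Scheme.IsRegular B := by
    intro O hP
    obtain ⟨B, pB, hpB, hB⟩ := hP
    refine ⟨B, pB ≫ (ρB.gluedι O).isoOpensRange.hom, ?_, hB⟩
    have h' := hpB.comp_iso (ρB.gluedι O).isoOpensRange
    rwa [← Scheme.IdealSheafData.comap_comp, Scheme.Hom.isoOpensRange_inv_comp] at h'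
  -- the pulled-back centre on the chart `Oᵢ/G` is the ideal sheaf of the image of `T ∩ Oᵢ`
  have hcomap : ∀ (O : ρB.StableAffineOpens), 𝓘.comap (ρB.gluedι O) =
      Scheme.IdealSheafData.vanishingIdeal (Z.preimage (ρB.gluedι O).continuous) := fun O =>
    comap_vanishingIdeal_of_isOpenImmersion _ _
  have hZpre : ∀ (O : ρB.StableAffineOpens),
      ((Z.preimage (ρB.gluedι O).continuous : Closeds (ρB.pieceQuot O)) : Set (ρB.pieceQuot O)) =
        (ρB.pieceMk O).base '' (O.1.ι.base ⁻¹' T) := fun O => by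
    rw [Closeds.coe_preimage, hZcoe, preimage_gluedι_image_gluedMk ρB hcov O T]
  -- the exit downstairs, then transport along `Y → X₁`
  have hres : Scheme.HasResolution ρB.glued := by
    refine BlowupExit.hasResolution_of_isBlowup_locally_regular₂ 𝓘 h𝓘 U hUcov 0 ?_ (U 3) ?_ ?_ ?_ ?_
    · -- pieces `1, 2, 3`
      intro i hi
      fin_cases i
      · exact absurd rfl hi
      · refine key O₁ ?_
        rw [hcomap]
        exact hP₁ _ (hZpre O₁)
      · refine key O₂ ?_
        rw [hcomap]
        exact hP₂ _ (hZpre O₂)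
      · refine key O₃ ⟨ρB.pieceQuot O₃, 𝟙 _, ?_, hQ⟩
        rw [BlowupExit.comap_vanishingIdeal_eq_top_of_disjoint Z _ (by rw [hZcoe]; exact hZ₃.symm)]
        exact isBlowup_id_top _
    · -- `O₃/G` is non-empty
      obtain ⟨v, hv⟩ := hO₃ne
      exact ⟨(ρB.gluedMk hcov).base v, (mem_range O₃ v).mpr hv⟩
    · -- `𝓘|_{O₃/G} = ⊤`
      rw [hU3, comap_vanishingIdeal_of_isOpenImmersion]
      have hempty : (Z.preimage (ρB.gluedι O₃).opensRange.ι.continuous :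
          Closeds ((ρB.gluedι O₃).opensRange : Scheme.{0})) = ⊥ := by
        ext x
        simp only [Closeds.coe_preimage, Set.mem_preimage, Closeds.coe_bot,
          Set.mem_empty_iff_false, iff_false]
        intro hx
        rw [hZcoe] at hx
        exact Set.disjoint_left.mp hZ₃ hx (by simp)
      rw [hempty, Scheme.IdealSheafData.vanishingIdeal_bot]
    · -- `O₃/G ⊆ ⋃_{j ≠ 0} U j`
      intro y hy
      exact ⟨3, by decide, hy⟩
    · -- piece `0`, depth two
      obtain ⟨B, pB, hpB, C, hC, B', pB', hpB', hB'⟩ := hP₀ _ (hZpre O₀)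
      rw [← hcomap] at hpB
      refine ⟨B, pB ≫ (ρB.gluedι O₀).isoOpensRange.hom, ?_, C, ?_, B', pB', hpB', hB'⟩
      · have h' := hpB.comp_iso (ρB.gluedι O₀).isoOpensRange
        rw [← Scheme.IdealSheafData.comap_comp, Scheme.Hom.isoOpensRange_inv_comp] at h'
        exact h'
      · intro b hb j hj hbj
        -- the point `pB b` is the image of some `x ∈ T' ∩ O₀`
        obtain ⟨x, hxT', hx⟩ := hC ⟨b, hb, rfl⟩
        have hval : (U 0).ι.base ((pB ≫ (ρB.gluedι O₀).isoOpensRange.hom).base b) =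
            (ρB.gluedMk hcov).base x.1 := by
          rw [ρB.gluedMk_apply hcov O₀ x, hx]
          change ((pB ≫ (ρB.gluedι O₀).isoOpensRange.hom) ≫ (ρB.gluedι O₀).opensRange.ι).base b =
            ((ρB.gluedι O₀).base (pB.base b))
          rw [Category.assoc, Scheme.Hom.isoOpensRange_hom_ι]
          rfl
        have hbj' : (ρB.gluedMk hcov).base x.1 ∈ U j := by
          convert hbj using 1
          exact hval.symm
        -- but `x ∉ O_j` for `j = 1, 2, 3`
        fin_cases j
        · exact hj rfl
        · exact Set.disjoint_left.mp hT'₁ hxT' ((mem_range O₁ x.1).mp hbj')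
        · exact Set.disjoint_left.mp hT'₂ hxT' ((mem_range O₂ x.1).mp hbj')
        · exact Set.disjoint_left.mp hT'₃ hxT' ((mem_range O₃ x.1).mp hbj')
  exact QuotientModel.hasResolution_of_hasResolution_glued k X' X₁ f q G ρ hfaith hdim hsurj hU
    horb V π hbir ρB hequiv hcov hres

end Summit.ResolutionOfSingularities.ResolutionOfSingularities.Theorems.WildQuotientResolution.ToricExit

end
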